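import Mathlib
import Literature.Computability.AlgebraicComplexity.RealTauKnownCases

/-!
# Crux `MatrixDescartes` (stmt-ValiantsHypothesis-18050), line `Lift` — registered stub `stub_diagonalSector`

The DIAGONAL SECTOR of the lacunary matrix Descartes bound.  If every coefficient of the pencil
`∑ₗ X^{dₗ} • Sₗ` (`l < K`, real `m × m` matrices) is diagonal, `Sₗ = diagonal (γ l)`, then the
pencil matrix is itself diagonal with diagonal entries `pᵢ := ∑ₗ γ l i · X^{dₗ}`
(`StubDiagonalSector.pencil_eq_diagonal`), so `det = ∏ᵢ pᵢ` (`Matrix.det_diagonal`).  Each `pᵢ`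
has at most `K` monomials (`StubDiagonalSector.card_support_entry_le`), hence, if nonzero, fewer
than `K` distinct positive zeros by the sparse Descartes rule (tree lemma
`Literature.Computability.AlgebraicComplexity.card_roots_toFinset_filter_pos_lt_card_support`).
A positive zero of a nonzero product is a positive zero of some factor, so the product has at most
`m (K − 1)` distinct positive zeros (`StubDiagonalSector.card_posRoots_prod_le`); the zero
polynomial has no roots counted at all (`Polynomial.roots_zero`).

Elementary; Mathlib plus the tree's sparse Descartes rule (axioms `propext`, `Classical.choice`,
`Quot.sound`).
-/

-- layout Summits/ValiantsHypothesis/ValiantsHypothesis forces the duplicated namespace component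
set_option linter.dupNamespace false

namespace Summit.ValiantsHypothesis.ValiantsHypothesis.Theorems.LacunarySymmetroidMatrixDescartes

open Polynomial Matrix Finset
open scoped BigOperators

namespace StubDiagonalSector

/-- A lacunary sum of `K` monomials `∑ₗ C (a l) * X^{d l}` has at most `K` monomials. -/
theorem card_support_entry_le (K : ℕ) (d : Fin K → ℕ) (a : Fin K → ℝ) :
    (∑ l, Polynomial.C (a l) * (Polynomial.X : Polynomial ℝ) ^ d l).support.card ≤ K := by
  calc (∑ l, Polynomial.C (a l) * (Polynomial.X : Polynomial ℝ) ^ d l).support.card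
      ≤ ∑ l, (Polynomial.C (a l) * (Polynomial.X : Polynomial ℝ) ^ d l).support.card :=
        Literature.Computability.AlgebraicComplexity.card_support_sum_le _ _
    _ ≤ ∑ _l : Fin K, 1 := sum_le_sum fun l _ => card_support_C_mul_X_pow_le_one
    _ = K := by simp

/-- With diagonal coefficients `Sₗ = diagonal (γ l)` the pencil matrix `∑ₗ X^{dₗ} • Sₗ` is the
diagonal matrix with entries `pᵢ = ∑ₗ C (γ l i) * X^{dₗ}`. -/
theorem pencil_eq_diagonal (K m : ℕ) (d : Fin K → ℕ) (γ : Fin K → Fin m → ℝ) :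
    (∑ l, ((Polynomial.X : Polynomial ℝ) ^ d l) • (Matrix.diagonal (γ l)).map Polynomial.C)
      = Matrix.diagonal fun i => ∑ l, Polynomial.C (γ l i) * (Polynomial.X : Polynomial ℝ) ^ d l := by
  refine Matrix.ext fun i j => ?_
  simp only [Matrix.sum_apply, Matrix.smul_apply, Matrix.map_apply, Matrix.diagonal_apply,
    smul_eq_mul]
  by_cases h : i = j
  · subst h
    simp only [if_true]
    exact sum_congr rfl fun l _ => mul_comm _ _
  · simp [h]

/-- A nonzero-or-zero product of `m` real polynomials, each with at most `K` monomials, has at most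
`m (K − 1)` distinct positive zeros: if the product vanishes no root is counted; otherwise every
factor is nonzero with fewer than `K` positive zeros (sparse Descartes), and a positive zero of the
product is one of some factor. -/
theorem card_posRoots_prod_le (K m : ℕ) (p : Fin m → Polynomial ℝ)
    (hp : ∀ i, (p i).support.card ≤ K) :
    ((∏ i, p i).roots.toFinset.filter (fun t => 0 < t)).card ≤ m * (K - 1) := by
  by_cases hP : ∏ i, p i = 0
  · rw [hP, Polynomial.roots_zero, Multiset.toFinset_zero, filter_empty, card_empty]
    exact Nat.zero_le _
  · have hpi : ∀ i, p i ≠ 0 := fun i h => hP (prod_eq_zero (mem_univ i) h)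
    -- positive zeros of the product are positive zeros of some factor
    have hsub : (∏ i, p i).roots.toFinset.filter (fun t => 0 < t) ⊆
        univ.biUnion fun i => (p i).roots.toFinset.filter (fun t => 0 < t) := by
      intro x hx
      simp only [mem_filter, Multiset.mem_toFinset, mem_roots hP, IsRoot.def, eval_prod,
        prod_eq_zero_iff] at hx
      obtain ⟨⟨i, -, hix⟩, hx0⟩ := hx
      simp only [mem_biUnion, mem_filter, Multiset.mem_toFinset]
      exact ⟨i, mem_univ i, (mem_roots (hpi i)).mpr (IsRoot.def.mpr hix), hx0⟩
    calc ((∏ i, p i).roots.toFinset.filter (fun t => 0 < t)).card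
        ≤ (univ.biUnion fun i => (p i).roots.toFinset.filter (fun t => 0 < t)).card :=
          card_le_card hsub
      _ ≤ ∑ i, ((p i).roots.toFinset.filter (fun t => 0 < t)).card := card_biUnion_le
      _ ≤ ∑ _i : Fin m, (K - 1) := sum_le_sum fun i _ => by
          have h1 := Literature.Computability.AlgebraicComplexity.card_roots_toFinset_filter_pos_lt_card_support (hpi i)
          have h2 := hp i
          omega
      _ = m * (K - 1) := by simp

end StubDiagonalSector

/-- **Registered stub `stub_diagonalSector`** (diagonal sector): if every coefficient is diagonal,
`Sₗ = diagonal (γ l)`, then `det (∑ₗ X^{dₗ} Sₗ) = ∏ᵢ (∑ₗ γ l i · X^{dₗ})` is a product of `m`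
polynomials with at most `K` monomials each, so it has at most `m (K − 1)` distinct positive zeros
(sparse Descartes rule factor by factor).  Degenerate cases are covered: `K = 0` gives the zero
matrix (`m > 0`: `det = 0`, no roots counted) or the empty one (`m = 0`: `det = 1`, no roots). -/
theorem stub_diagonalSector (K m : ℕ) (d : Fin K → ℕ) (γ : Fin K → Fin m → ℝ) :
    ((Matrix.det (∑ l, ((Polynomial.X : Polynomial ℝ) ^ d l) •
        (Matrix.diagonal (γ l)).map Polynomial.C)).roots.toFinset.filter (fun t => 0 < t)).card
      ≤ m * (K - 1) := by
  rw [StubDiagonalSector.pencil_eq_diagonal, Matrix.det_diagonal]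
  exact StubDiagonalSector.card_posRoots_prod_le K m _
    fun i => StubDiagonalSector.card_support_entry_le K d fun l => γ l i

end Summit.ValiantsHypothesis.ValiantsHypothesis.Theorems.LacunarySymmetroidMatrixDescartes
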